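import Summits.KontsevichZagierPeriods.Zeta5Search.Certificates.RayC1DualNumerics
import HarnessLib

/-!
# ζ(5) search — certificates: the dual series of the ray RayC1 (`e = 0`: b itself) — the WINDOW bound
(cell `pub-zeta5`, P1 g11; port of certifier 2's `RecordRayDualSeriesWindow/Rate`)

HONEST FRAMING: systematic search; no irrationality claim unless certified.

OUR work (Summit side). `Hc1E0 n μ` = the entropy combination of `log T̂(μ)` for `B = BC1E 0 n`;
`Hc1E0_window_le` (tangent bounds keeping the cancellation), `slopec1E0_le` (the window slope is `≤ Λ⁺` for `n ≥ 100`),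
`Hc1E0_base_le` (floor stability at `μ₀ = 2n/5 − 1`), and **`Hc1E0_window_bound`**:
`H(n, μ) ≤ n·(ĥ(2/5) + Λ⁺/20) + 2Λ⁺ + 96(1 + log(86n))` on `2n/5 − 1 ≤ μ ≤ 9n/20 + 1` (`n ≥ 100`).
-/

noncomputable section

open Finset Real

namespace Summit.KontsevichZagierPeriods.Zeta5Search.RayC1

open Summit.KontsevichZagierPeriods.Zeta5Search.RecordRay (ent ent_shift_le ent_shift_ge log_le_log_sub ent_scale
  ent_pred_le ent_pred_ge ent_ge_of_near)

/-- `H(n, μ) = ent(85n+μ+1, μ) − Σ_j ent(m_j, k_j)` for `B = BC1E 0 n`. -/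
def Hc1E0 (n μ : ℝ) : ℝ :=
  ent (85 * n + μ + 1) μ - (ent (50 * n + μ + 1) (35 * n + μ) + ent (53 * n + μ + 1) (32 * n + μ) + ent (55 * n + μ + 1) (30 * n + μ) + ent (58 * n + μ + 1) (27 * n + μ) + ent (60 * n + μ + 1) (25 * n + μ) + ent (63 * n + μ + 1) (22 * n + μ) + ent (65 * n + μ + 1) (20 * n + μ))

/-- The explicit slope of the window inequality. -/
def slopec1E0 (n μ₀ μ₁ : ℝ) : ℝ :=
  (Real.log (85 * n + μ₁ + 1) - Real.log μ₀) - ((Real.log (50 * n + μ₀ + 1) - Real.log (35 * n + μ₁)) + (Real.log (53 * n + μ₀ + 1) - Real.log (32 * n + μ₁)) + (Real.log (55 * n + μ₀ + 1) - Real.log (30 * n + μ₁)) + (Real.log (58 * n + μ₀ + 1) - Real.log (27 * n + μ₁)) + (Real.log (60 * n + μ₀ + 1) - Real.log (25 * n + μ₁)) + (Real.log (63 * n + μ₀ + 1) - Real.log (22 * n + μ₁)) + (Real.log (65 * n + μ₀ + 1) - Real.log (20 * n + μ₁)))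

set_option maxHeartbeats 800000 in
-- fourteen tangent inequalities assembled by one `linarith`
/-- **Window inequality**: for `1 ≤ n`, `0 < μ₀ ≤ μ ≤ μ₁`: `H(n, μ) ≤ H(n, μ₀) + (μ − μ₀)·slope(n, μ₀, μ₁)`. -/
theorem Hc1E0_window_le {n μ₀ μ μ₁ : ℝ} (hn : 1 ≤ n) (h0 : 0 < μ₀) (h01 : μ₀ ≤ μ) (h1 : μ ≤ μ₁) :
    Hc1E0 n μ ≤ Hc1E0 n μ₀ + (μ - μ₀) * slopec1E0 n μ₀ μ₁ := by
  have hδ : 0 ≤ μ - μ₀ := by linarith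
  have hnum := ent_shift_le (m := 85 * n + μ₀ + 1) (k := μ₀) (δ := μ - μ₀) (by linarith) h0 hδ
  have hnum' : (μ - μ₀) * (Real.log (85 * n + μ₀ + 1 + (μ - μ₀)) - Real.log μ₀) ≤
      (μ - μ₀) * (Real.log (85 * n + μ₁ + 1) - Real.log μ₀) := by
    apply mul_le_mul_of_nonneg_left _ hδ
    have := Real.log_le_log (by linarith : 0 < 85 * n + μ₀ + 1 + (μ - μ₀)) (by linarith : 85 * n + μ₀ + 1 + (μ - μ₀) ≤ 85 * n + μ₁ + 1)
    linarith
  have en : 85 * n + μ₀ + 1 + (μ - μ₀) = 85 * n + μ + 1 := by ring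
  have ek : μ₀ + (μ - μ₀) = μ := by ring
  rw [en, ek] at hnum
  rw [en] at hnum'
  have hd0 : (μ - μ₀) * (Real.log (50 * n + μ₀ + 1) - Real.log (35 * n + μ₁)) ≤ ent (50 * n + μ + 1) (35 * n + μ) - ent (50 * n + μ₀ + 1) (35 * n + μ₀) := by
    have h := ent_shift_ge (m := (50 * n + μ₀ + 1)) (k := (35 * n + μ₀)) (δ := μ - μ₀) (by linarith) (by linarith) hδ
    have eM : (50 * n + μ₀ + 1) + (μ - μ₀) = (50 * n + μ + 1) := by ring
    have eK : (35 * n + μ₀) + (μ - μ₀) = (35 * n + μ) := by ring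
    rw [eM, eK] at h
    have hmono : Real.log (35 * n + μ) ≤ Real.log (35 * n + μ₁) := Real.log_le_log (by linarith) (by linarith)
    have hmul : (μ - μ₀) * (Real.log (50 * n + μ₀ + 1) - Real.log (35 * n + μ₁)) ≤ (μ - μ₀) * (Real.log (50 * n + μ₀ + 1) - Real.log (35 * n + μ)) := by
      apply mul_le_mul_of_nonneg_left _ hδ; linarith
    linarith
  have hd1 : (μ - μ₀) * (Real.log (53 * n + μ₀ + 1) - Real.log (32 * n + μ₁)) ≤ ent (53 * n + μ + 1) (32 * n + μ) - ent (53 * n + μ₀ + 1) (32 * n + μ₀) := by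
    have h := ent_shift_ge (m := (53 * n + μ₀ + 1)) (k := (32 * n + μ₀)) (δ := μ - μ₀) (by linarith) (by linarith) hδ
    have eM : (53 * n + μ₀ + 1) + (μ - μ₀) = (53 * n + μ + 1) := by ring
    have eK : (32 * n + μ₀) + (μ - μ₀) = (32 * n + μ) := by ring
    rw [eM, eK] at h
    have hmono : Real.log (32 * n + μ) ≤ Real.log (32 * n + μ₁) := Real.log_le_log (by linarith) (by linarith)
    have hmul : (μ - μ₀) * (Real.log (53 * n + μ₀ + 1) - Real.log (32 * n + μ₁)) ≤ (μ - μ₀) * (Real.log (53 * n + μ₀ + 1) - Real.log (32 * n + μ)) := by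
      apply mul_le_mul_of_nonneg_left _ hδ; linarith
    linarith
  have hd2 : (μ - μ₀) * (Real.log (55 * n + μ₀ + 1) - Real.log (30 * n + μ₁)) ≤ ent (55 * n + μ + 1) (30 * n + μ) - ent (55 * n + μ₀ + 1) (30 * n + μ₀) := by
    have h := ent_shift_ge (m := (55 * n + μ₀ + 1)) (k := (30 * n + μ₀)) (δ := μ - μ₀) (by linarith) (by linarith) hδ
    have eM : (55 * n + μ₀ + 1) + (μ - μ₀) = (55 * n + μ + 1) := by ring
    have eK : (30 * n + μ₀) + (μ - μ₀) = (30 * n + μ) := by ring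
    rw [eM, eK] at h
    have hmono : Real.log (30 * n + μ) ≤ Real.log (30 * n + μ₁) := Real.log_le_log (by linarith) (by linarith)
    have hmul : (μ - μ₀) * (Real.log (55 * n + μ₀ + 1) - Real.log (30 * n + μ₁)) ≤ (μ - μ₀) * (Real.log (55 * n + μ₀ + 1) - Real.log (30 * n + μ)) := by
      apply mul_le_mul_of_nonneg_left _ hδ; linarith
    linarith
  have hd3 : (μ - μ₀) * (Real.log (58 * n + μ₀ + 1) - Real.log (27 * n + μ₁)) ≤ ent (58 * n + μ + 1) (27 * n + μ) - ent (58 * n + μ₀ + 1) (27 * n + μ₀) := by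
    have h := ent_shift_ge (m := (58 * n + μ₀ + 1)) (k := (27 * n + μ₀)) (δ := μ - μ₀) (by linarith) (by linarith) hδ
    have eM : (58 * n + μ₀ + 1) + (μ - μ₀) = (58 * n + μ + 1) := by ring
    have eK : (27 * n + μ₀) + (μ - μ₀) = (27 * n + μ) := by ring
    rw [eM, eK] at h
    have hmono : Real.log (27 * n + μ) ≤ Real.log (27 * n + μ₁) := Real.log_le_log (by linarith) (by linarith)
    have hmul : (μ - μ₀) * (Real.log (58 * n + μ₀ + 1) - Real.log (27 * n + μ₁)) ≤ (μ - μ₀) * (Real.log (58 * n + μ₀ + 1) - Real.log (27 * n + μ)) := by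
      apply mul_le_mul_of_nonneg_left _ hδ; linarith
    linarith
  have hd4 : (μ - μ₀) * (Real.log (60 * n + μ₀ + 1) - Real.log (25 * n + μ₁)) ≤ ent (60 * n + μ + 1) (25 * n + μ) - ent (60 * n + μ₀ + 1) (25 * n + μ₀) := by
    have h := ent_shift_ge (m := (60 * n + μ₀ + 1)) (k := (25 * n + μ₀)) (δ := μ - μ₀) (by linarith) (by linarith) hδ
    have eM : (60 * n + μ₀ + 1) + (μ - μ₀) = (60 * n + μ + 1) := by ring
    have eK : (25 * n + μ₀) + (μ - μ₀) = (25 * n + μ) := by ring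
    rw [eM, eK] at h
    have hmono : Real.log (25 * n + μ) ≤ Real.log (25 * n + μ₁) := Real.log_le_log (by linarith) (by linarith)
    have hmul : (μ - μ₀) * (Real.log (60 * n + μ₀ + 1) - Real.log (25 * n + μ₁)) ≤ (μ - μ₀) * (Real.log (60 * n + μ₀ + 1) - Real.log (25 * n + μ)) := by
      apply mul_le_mul_of_nonneg_left _ hδ; linarith
    linarith
  have hd5 : (μ - μ₀) * (Real.log (63 * n + μ₀ + 1) - Real.log (22 * n + μ₁)) ≤ ent (63 * n + μ + 1) (22 * n + μ) - ent (63 * n + μ₀ + 1) (22 * n + μ₀) := by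
    have h := ent_shift_ge (m := (63 * n + μ₀ + 1)) (k := (22 * n + μ₀)) (δ := μ - μ₀) (by linarith) (by linarith) hδ
    have eM : (63 * n + μ₀ + 1) + (μ - μ₀) = (63 * n + μ + 1) := by ring
    have eK : (22 * n + μ₀) + (μ - μ₀) = (22 * n + μ) := by ring
    rw [eM, eK] at h
    have hmono : Real.log (22 * n + μ) ≤ Real.log (22 * n + μ₁) := Real.log_le_log (by linarith) (by linarith)
    have hmul : (μ - μ₀) * (Real.log (63 * n + μ₀ + 1) - Real.log (22 * n + μ₁)) ≤ (μ - μ₀) * (Real.log (63 * n + μ₀ + 1) - Real.log (22 * n + μ)) := by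
      apply mul_le_mul_of_nonneg_left _ hδ; linarith
    linarith
  have hd6 : (μ - μ₀) * (Real.log (65 * n + μ₀ + 1) - Real.log (20 * n + μ₁)) ≤ ent (65 * n + μ + 1) (20 * n + μ) - ent (65 * n + μ₀ + 1) (20 * n + μ₀) := by
    have h := ent_shift_ge (m := (65 * n + μ₀ + 1)) (k := (20 * n + μ₀)) (δ := μ - μ₀) (by linarith) (by linarith) hδ
    have eM : (65 * n + μ₀ + 1) + (μ - μ₀) = (65 * n + μ + 1) := by ring
    have eK : (20 * n + μ₀) + (μ - μ₀) = (20 * n + μ) := by ring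
    rw [eM, eK] at h
    have hmono : Real.log (20 * n + μ) ≤ Real.log (20 * n + μ₁) := Real.log_le_log (by linarith) (by linarith)
    have hmul : (μ - μ₀) * (Real.log (65 * n + μ₀ + 1) - Real.log (20 * n + μ₁)) ≤ (μ - μ₀) * (Real.log (65 * n + μ₀ + 1) - Real.log (20 * n + μ)) := by
      apply mul_le_mul_of_nonneg_left _ hδ; linarith
    linarith
  unfold Hc1E0 slopec1E0
  rw [mul_sub]
  linarith [hd0, hd1, hd2, hd3, hd4, hd5, hd6, hnum, hnum']

/-- **The slope of the window is `≤ Λ⁺`** for `n ≥ 100` (`μ₀ = 2n/5 − 1`, `μ₁ = 9n/20 + 1`). -/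
theorem slopec1E0_le {n : ℝ} (hn : 100 ≤ n) :
    slopec1E0 n (2 / 5 * n - 1) (9 / 20 * n + 1) ≤ lambdaPlusc1 := by
  unfold slopec1E0 lambdaPlusc1
  have h0 : 0 < 2 / 5 * n - 1 := by linarith
  have hnum : Real.log (85 * n + (9 / 20 * n + 1) + 1) - Real.log (2 / 5 * n - 1) ≤ Real.log 220 := by
    have h := Real.log_le_log (by linarith : 0 < 85 * n + (9 / 20 * n + 1) + 1)
      (show 85 * n + (9 / 20 * n + 1) + 1 ≤ 220 * (2 / 5 * n - 1) by linarith)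
    rw [Real.log_mul (by norm_num) h0.ne'] at h
    linarith
  have e0 := log_le_log_sub (a := 50 * n + (2 / 5 * n - 1) + 1) (b := 35 * n + (9 / 20 * n + 1)) (c := 504 / 355)
    (by linarith) (by norm_num) (by linarith)
  have e1 := log_le_log_sub (a := 53 * n + (2 / 5 * n - 1) + 1) (b := 32 * n + (9 / 20 * n + 1)) (c := 534 / 325)
    (by linarith) (by norm_num) (by linarith)
  have e2 := log_le_log_sub (a := 55 * n + (2 / 5 * n - 1) + 1) (b := 30 * n + (9 / 20 * n + 1)) (c := 554 / 305)
    (by linarith) (by norm_num) (by linarith)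
  have e3 := log_le_log_sub (a := 58 * n + (2 / 5 * n - 1) + 1) (b := 27 * n + (9 / 20 * n + 1)) (c := 584 / 275)
    (by linarith) (by norm_num) (by linarith)
  have e4 := log_le_log_sub (a := 60 * n + (2 / 5 * n - 1) + 1) (b := 25 * n + (9 / 20 * n + 1)) (c := 604 / 255)
    (by linarith) (by norm_num) (by linarith)
  have e5 := log_le_log_sub (a := 63 * n + (2 / 5 * n - 1) + 1) (b := 22 * n + (9 / 20 * n + 1)) (c := 634 / 225)
    (by linarith) (by norm_num) (by linarith)
  have e6 := log_le_log_sub (a := 65 * n + (2 / 5 * n - 1) + 1) (b := 20 * n + (9 / 20 * n + 1)) (c := 654 / 205)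
    (by linarith) (by norm_num) (by linarith)
  norm_num only at e0 e1 e2 e3 e4 e5 e6 ⊢
  linarith

/-- **Base value**: `H(n, 2n/5 − 1) ≤ n·ĥ(2/5) + 96·(1 + log(86n))` for `n ≥ 10`. -/
theorem Hc1E0_base_le {n : ℝ} (hn : 10 ≤ n) :
    Hc1E0 n (2 / 5 * n - 1) ≤ n * hhatc1 + 96 * (1 + Real.log (86 * n)) := by
  have hn0 : 0 < n := by linarith
  have eN : ent (85 * n + (2 / 5 * n - 1) + 1) (2 / 5 * n - 1) = ent (427 / 5 * n) (2 / 5 * n - 1) := by congr 1; ring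
  have e0 : ent (50 * n + (2 / 5 * n - 1) + 1) (35 * n + (2 / 5 * n - 1)) = ent (252 / 5 * n) (177 / 5 * n - 1) := by congr 1 <;> ring
  have e1 : ent (53 * n + (2 / 5 * n - 1) + 1) (32 * n + (2 / 5 * n - 1)) = ent (267 / 5 * n) (162 / 5 * n - 1) := by congr 1 <;> ring
  have e2 : ent (55 * n + (2 / 5 * n - 1) + 1) (30 * n + (2 / 5 * n - 1)) = ent (277 / 5 * n) (152 / 5 * n - 1) := by congr 1 <;> ring
  have e3 : ent (58 * n + (2 / 5 * n - 1) + 1) (27 * n + (2 / 5 * n - 1)) = ent (292 / 5 * n) (137 / 5 * n - 1) := by congr 1 <;> ring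
  have e4 : ent (60 * n + (2 / 5 * n - 1) + 1) (25 * n + (2 / 5 * n - 1)) = ent (302 / 5 * n) (127 / 5 * n - 1) := by congr 1 <;> ring
  have e5 : ent (63 * n + (2 / 5 * n - 1) + 1) (22 * n + (2 / 5 * n - 1)) = ent (317 / 5 * n) (112 / 5 * n - 1) := by congr 1 <;> ring
  have e6 : ent (65 * n + (2 / 5 * n - 1) + 1) (20 * n + (2 / 5 * n - 1)) = ent (327 / 5 * n) (102 / 5 * n - 1) := by congr 1 <;> ring
  unfold Hc1E0
  rw [eN, e0, e1, e2, e3, e4, e5, e6]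
  have aN := ent_pred_le (m := 427 / 5 * n) (k := 2 / 5 * n) (M := 86 * n) (by linarith only [hn]) (by linarith only [hn]) (by linarith only [hn])
  have b0 := ent_pred_ge (m := 252 / 5 * n) (k := 177 / 5 * n) (M := 86 * n) (by linarith only [hn]) (by linarith only [hn]) (by linarith only [hn])
  have b1 := ent_pred_ge (m := 267 / 5 * n) (k := 162 / 5 * n) (M := 86 * n) (by linarith only [hn]) (by linarith only [hn]) (by linarith only [hn])
  have b2 := ent_pred_ge (m := 277 / 5 * n) (k := 152 / 5 * n) (M := 86 * n) (by linarith only [hn]) (by linarith only [hn]) (by linarith only [hn])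
  have b3 := ent_pred_ge (m := 292 / 5 * n) (k := 137 / 5 * n) (M := 86 * n) (by linarith only [hn]) (by linarith only [hn]) (by linarith only [hn])
  have b4 := ent_pred_ge (m := 302 / 5 * n) (k := 127 / 5 * n) (M := 86 * n) (by linarith only [hn]) (by linarith only [hn]) (by linarith only [hn])
  have b5 := ent_pred_ge (m := 317 / 5 * n) (k := 112 / 5 * n) (M := 86 * n) (by linarith only [hn]) (by linarith only [hn]) (by linarith only [hn])
  have b6 := ent_pred_ge (m := 327 / 5 * n) (k := 102 / 5 * n) (M := 86 * n) (by linarith only [hn]) (by linarith only [hn]) (by linarith only [hn])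
  have sN := ent_scale hn0 (427 / 5) (2 / 5)
  have s0 := ent_scale hn0 (252 / 5) (177 / 5)
  have s1 := ent_scale hn0 (267 / 5) (162 / 5)
  have s2 := ent_scale hn0 (277 / 5) (152 / 5)
  have s3 := ent_scale hn0 (292 / 5) (137 / 5)
  have s4 := ent_scale hn0 (302 / 5) (127 / 5)
  have s5 := ent_scale hn0 (317 / 5) (112 / 5)
  have s6 := ent_scale hn0 (327 / 5) (102 / 5)
  have hh : n * hhatc1 = n * ent (427 / 5) (2 / 5) - (n * ent (252 / 5) (177 / 5) + n * ent (267 / 5) (162 / 5) + n * ent (277 / 5) (152 / 5) + n * ent (292 / 5) (137 / 5) + n * ent (302 / 5) (127 / 5) + n * ent (317 / 5) (112 / 5) + n * ent (327 / 5) (102 / 5)) := by unfold hhatc1; ring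
  rw [hh, ← sN, ← s0, ← s1, ← s2, ← s3, ← s4, ← s5, ← s6]
  linarith only [aN, b0, b1, b2, b3, b4, b5, b6]

/-- **Window bound**: for `n ≥ 100` and `2n/5 − 1 ≤ μ ≤ 9n/20 + 1`,
`H(n, μ) ≤ n·(ĥ(2/5) + Λ⁺/20) + 2Λ⁺ + 96·(1 + log(86n))`. -/
theorem Hc1E0_window_bound {n μ : ℝ} (hn : 100 ≤ n) (hlo : 2 / 5 * n - 1 ≤ μ) (hhi : μ ≤ 9 / 20 * n + 1) :
    Hc1E0 n μ ≤ n * (hhatc1 + lambdaPlusc1 / 20) + 2 * lambdaPlusc1 + 96 * (1 + Real.log (86 * n)) := by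
  have hw := Hc1E0_window_le (n := n) (μ₀ := 2 / 5 * n - 1) (μ := μ) (μ₁ := 9 / 20 * n + 1) (by linarith) (by linarith) hlo hhi
  have hs := slopec1E0_le hn
  have hb := Hc1E0_base_le (n := n) (by linarith)
  obtain ⟨lp0, -⟩ := lambdaPlusc1_bounds
  have hδ : 0 ≤ μ - (2 / 5 * n - 1) := by linarith
  have h1 : (μ - (2 / 5 * n - 1)) * slopec1E0 n (2 / 5 * n - 1) (9 / 20 * n + 1) ≤ (μ - (2 / 5 * n - 1)) * lambdaPlusc1 :=
    mul_le_mul_of_nonneg_left hs hδ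
  have h2 : (μ - (2 / 5 * n - 1)) * lambdaPlusc1 ≤ (n / 20 + 2) * lambdaPlusc1 :=
    mul_le_mul_of_nonneg_right (by linarith) (by linarith)
  nlinarith [hw, h1, h2, hb]

end Summit.KontsevichZagierPeriods.Zeta5Search.RayC1
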